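/-
Copyright: public-domain mathematics; formalisation produced inside the b2b autopsy cell `lwe-quantum-autopsy`
(Part 1, generation 17).  Source analysed: Yilei Chen, "Quantum Algorithms for Lattice Problems",
IACR ePrint 2024/555, version of 2024-04-18 (WITHDRAWN by the author: "Step 9 of the algorithm contains a
bug, which I don't know how to fix").  Bib key `ChenQuantumLattice2024`.
REPRODUCTION / ANALYSIS OF A CLAIMED RESULT UNDER ADJUDICATION (withdrawn).  HONEST FRAMING: a theorem about
the measurement step of a withdrawn algorithm; it repairs nothing, breaks nothing, and is not progress on any
lattice problem or on the summit `QuantumAdvantage` — its value is a precise, kernel-checked constant.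
-/
import Literature.Computability.Cryptography.ChenQuantumLWEThresholdPrimeExact

/-!
# Chen (2024), Step 8: the measurement ceiling FAILS at `ε = 1/(p² + 1)` for every prime `p ∣ Q`

HONEST FRAMING.  The value of this file is a kernel-checked THEOREM about one step of a WITHDRAWN quantum
algorithm (Chen, ePrint 2024/555 v. 2024-04-18, §3.5.8 Step 8).  It is NOT progress on any summit problem,
breaks nothing, repairs nothing, and makes no cryptanalytic claim.

## What was known in the tree

For the Step-8 orbit pair `S`, `(b, v′ + 2D²p₁b)` (same `step8Output`, different `step9Needs`) and the class
`InClass U` of instances Step 8 cannot tell apart: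
* (Z) `Shape.step8_povm_ceiling_largestPrime`: every `ε`-almost-sure POVM gives the pair the same almost-certain
  outcome as soon as `32·ε·𝔭(Q)² ≤ 1` (`𝔭(Q)` = largest prime factor of `Q`);
* (Y) `Shape.step8_povm_ceiling_fails_at_inv_prime_sq`: at `ε = 1/p²`, for every prime `p ∣ Q`, the
  DIVISOR-ORBIT measurement `{Π, 1 − Π}` (`Π` = projector onto the span of the `Q/p`-orbit of `S`) is almost sure
  on the class and separates the pair;
* (AC) `Shape.step8_povm_ceiling_fails_at_threshold`: at `ε = 1/(minFac(Q)² + 1)` the DAMPED rank-one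
  measurement `{λ|S⟩⟨S|, 1 − λ|S⟩⟨S|}` does the same;
* (AC)+(AD) `Shape.step8_tolerance_threshold_all_primes`: for PRIME `Q` the threshold is exactly `1/(Q² + 1)`.
So for composite `Q` the failure point stood at `min(1/𝔭(Q)², 1/(minFac(Q)² + 1))`.

## What is proved here

* `Shape.divisorOrbit_weight_dichotomy` — the SHARP form of (Y)'s dichotomy: for `Q = A·C`, `C > 1`, every
  member of the class is either CERTAINLY inside the divisor-orbit span (weight of `Π` equal to its squared
  norm) or has `Π`-weight at most `⟨u|u⟩/minFac(C)²` ((Y) only recorded the consequence "almost certain at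
  `1/minFac(C)²`", which forgets that the first alternative is exact).
* `Shape.step8_povm_ceiling_fails_at_inv_minFac_divisor_sq_succ` — damping `Π` by `λ = 1 − 1/(minFac(C)² + 1)`
  ((AC)'s `POVM.damp`) gives an almost-sure separating measurement at `ε = 1/(minFac(C)² + 1)`;
* `Shape.step8_povm_ceiling_fails_at_inv_prime_sq_succ` — **failure at `1/(p² + 1)` for EVERY prime `p ∣ Q`**, in
  particular at `1/(𝔭(Q)² + 1)`; for prime `Q` (`A = 1`) the divisor orbit is the single state `S` and the
  witness is (AC)'s damped rank-one measurement, whose value `1/(Q² + 1)` is exact by (AD);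
* `Shape.step8_povm_ceiling_window` — packaged with (Z): for EVERY admissible `Q` the tolerance threshold of the
  Step-8 measurement ceiling lies in `[1/(32·𝔭(Q)²), 1/(𝔭(Q)² + 1)]`, and equals the upper end when `Q` is prime.

## What is NOT proved (open, recorded for the next generation)

Whether the threshold equals `1/(𝔭(Q)² + 1)` for composite `Q`.  A plausible route: (Z)'s induction over the
divisor lattice (`Shape.outInv_of_dvd`) with the elementary step `H₀ → p·H₀` re-proved by the Hilbert–Schmidt
Cauchy–Schwarz inequality of (AD) (`sq_sum_weight_le`) applied to BOX frames (the `H₀`-orbit boxes, outcome-constant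
by the induction hypothesis, in place of single rays); at the finest level the boxes are rays and the step is
literally (AD)'s `MUBFrames.sameOutcome₃` with `q = p`.  This file does not attempt it.

References: [ChenQuantumLattice2024] Y. Chen, Quantum Algorithms for Lattice Problems, IACR ePrint 2024/555,
version 2024-04-18: Cond. C.3 p. 18, §3.1 p. 22, eq. (35) p. 31, §3.5.8 pp. 33–34, p. 37;
[NielsenChuang2010] M. Nielsen, I. Chuang, Quantum Computation and Quantum Information, CUP 2010, §2.2.6 p. 90
(POVM formalism), Box 2.3 p. 87.
-/

open scoped BigOperators ComplexOrder MatrixOrder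
open Matrix Finset

namespace Literature.Computability.Cryptography.Chen2024

/-! ## Part I.  Two more facts about the binary frame measurement `{Π, 1 − Π}` -/

namespace POVM

section FrameBinary

variable {X ι : Type*} [Fintype X] [DecidableEq X] [Fintype ι] [DecidableEq ι]

/-- Outcome `0` of `{Π, 1 − Π}` is CERTAIN (weight = squared norm) on every frame member.
[cite: NielsenChuang2010, §2.2.6 p. 90] -/
theorem ofFrameBinary_certain_zero_self (w : ι → X → ℂ) {ν : ℝ} (hν : 0 < ν)
    (horth : ∀ j k, star (w j) ⬝ᵥ w k = if j = k then ((ν : ℝ) : ℂ) else 0) (j₀ : ι) :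
    (ofFrameBinary w hν horth).Certain (w j₀) 0 := by
  unfold Certain
  rw [ofFrameBinary_weight_zero, frame_weight_self w hν horth j₀, horth j₀ j₀, if_pos rfl,
    Complex.ofReal_re]

/-- Outcome `0` of `{Π, 1 − Π}` has weight `0` on every vector orthogonal to the frame.
[cite: NielsenChuang2010, §2.2.6 p. 90] -/
theorem ofFrameBinary_weight_zero_of_orthogonal (w : ι → X → ℂ) {ν : ℝ} (hν : 0 < ν)
    (horth : ∀ j k, star (w j) ⬝ᵥ w k = if j = k then ((ν : ℝ) : ℂ) else 0) (φ : X → ℂ)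
    (h0 : ∀ j, star (w j) ⬝ᵥ φ = 0) : (ofFrameBinary w hν horth).weight φ 0 = 0 := by
  rw [ofFrameBinary_weight_zero]
  have hz : ∀ j, ν⁻¹ * ‖star (w j) ⬝ᵥ φ‖ ^ 2 = 0 := fun j => by rw [h0 j, norm_zero]; ring
  simp_rw [hz, Finset.sum_const_zero]
  push_cast
  rfl

end FrameBinary

section Damp

variable {X : Type*} [Fintype X] [DecidableEq X]

/-- After damping, outcome `1` is `ε`-almost certain (every `ε ≥ 0`) on each vector on which outcome `0` had
weight `0`. [cite: NielsenChuang2010, §2.2.6 p. 90] -/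
theorem damp_almostCertain_one_of_weight_zero (E : POVM X (Fin 2)) {l ε : ℝ} (hl0 : 0 ≤ l) (hl1 : l ≤ 1)
    (hε : 0 ≤ ε) {φ : X → ℂ} (hw : E.weight φ 0 = 0) : (E.damp l hl0 hl1).AlmostCertain ε φ 1 :=
  E.damp_almostCertain_one hl0 hl1 (μ := 0) (by rw [hw, Complex.zero_re, zero_mul])
    (by rw [mul_zero]; exact hε)

end Damp

/-- The damping arithmetic: `(1 − 1/(m² + 1))·(1/m²) = 1/(m² + 1)`. [folklore] -/
theorem damp_factor_eq {m : ℝ} (hm : 0 < m) : (1 - 1 / (m ^ 2 + 1)) * (1 / m ^ 2) = 1 / (m ^ 2 + 1) := by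
  have hm2 : m ^ 2 ≠ 0 := by positivity
  have hm3 : m ^ 2 + 1 ≠ 0 := by positivity
  field_simp
  ring

end POVM

/-! ## Part II.  The sharp dichotomy of the divisor-orbit measurement -/

namespace Shape

variable (S : Shape)

/-- **THE SHARP DICHOTOMY.**  For `Q = A·C`, `C > 1`, and the divisor-orbit measurement `{Π, 1 − Π}` based at
`(x₀, ȳ₀)`: every member `(β; x′, ȳ′)` of the shape's class either has outcome `0` CERTAINLY (it lies in the
orbit span: `Π`-weight `= ⟨u|u⟩`) or has `Π`-weight at most `⟨u|u⟩/minFac(C)²` (weight `0` in the remaining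
`A·β = 0` cases, `≤ ⟨u|u⟩/minFac(C)²` when `A·β ≠ 0`, by (Y)'s `divisorOrbit_normSq_sum` and `orbN_orbZ_bound`).
Sharpens (Y) `divisorOrbit_almostCertain`, whose conclusion "almost certain at `1/minFac(C)²`" forgets that the
first alternative is exact. [cite: ChenQuantumLattice2024, §3.1 p. 22, Cond. C.3 p. 18, eq. (35) p. 31;
NielsenChuang2010, §2.2.6 p. 90] -/
theorem divisorOrbit_weight_dichotomy (h : S.Admissible) {A C : ℕ} (hQ : (S.Q : ℕ) = A * C) (hC : 1 < C)
    (x₀ : ZMod S.Q) (y₀ : Fin S.n → ZMod S.Q) (β : Fin S.n → ZMod S.Q) (x' : ZMod S.Q)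
    (y' : Fin S.n → ZMod S.Q) :
    (S.orbitPOVM h A x₀ y₀).Certain (S.uKet β x' y') 0
    ∨ ((S.orbitPOVM h A x₀ y₀).weight (S.uKet β x' y') 0).re
        ≤ 1 / (C.minFac : ℝ) ^ 2 * (star (S.uKet β x' y') ⬝ᵥ S.uKet β x' y').re := by
  classical
  have hν : 0 < S.frameNormSq := S.frameNormSq_pos
  have hq : (0 : ℝ) < ((S.Q : ℕ) : ℝ) := by exact_mod_cast S.Q.pos
  have hνO : 0 < S.frameNormSq / ((S.Q : ℕ) : ℝ) ^ S.n := S.frameNormSq_div_pos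
  have hmF : (0 : ℝ) < (C.minFac : ℝ) := by exact_mod_cast Nat.minFac_pos C
  have hself : star (S.uKet β x' y') ⬝ᵥ S.uKet β x' y'
      = (((S.frameNormSq / ((S.Q : ℕ) : ℝ) ^ S.n : ℝ)) : ℂ) := S.star_uKet_self h β x' y'
  have hselfre : (star (S.uKet β x' y') ⬝ᵥ S.uKet β x' y').re = S.frameNormSq / ((S.Q : ℕ) : ℝ) ^ S.n := by
    rw [hself, Complex.ofReal_re]
  -- the total frame weight `W` and its closed form ((Y), Part V)
  set W : ℝ := ∑ j : S.OrbitIdx A, ‖star (S.orbitVec A x₀ y₀ j) ⬝ᵥ S.uKet β x' y'‖ ^ 2 with hWdef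
  have hW0 : 0 ≤ W := Finset.sum_nonneg fun j _ => by positivity
  have hWC : ((W : ℝ) : ℂ) = ((A : ℂ)) ^ S.n
      * ((((S.frameNormSq : ℝ) : ℂ)) ^ 2 * ((1 / ((S.Q : ℕ) : ℂ) ^ S.n) ^ 2) ^ 2)
      * (S.orbN A x₀ β x' : ℂ) * S.orbGamma C x₀ y₀ β x' y' := by
    rw [hWdef, Complex.ofReal_sum]
    exact S.divisorOrbit_normSq_sum h hQ x₀ y₀ β x' y'
  -- the weight of outcome `0` is `ν′⁻¹·W`
  have hwt : (S.orbitPOVM h A x₀ y₀).weight (S.uKet β x' y') 0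
      = (((∑ j : S.OrbitIdx A, (S.frameNormSq / ((S.Q : ℕ) : ℝ) ^ S.n)⁻¹
          * ‖star (S.orbitVec A x₀ y₀ j) ⬝ᵥ S.uKet β x' y'‖ ^ 2 : ℝ)) : ℂ) :=
    POVM.ofFrameBinary_weight_zero _ _ _ _
  have hwre : ((S.orbitPOVM h A x₀ y₀).weight (S.uKet β x' y') 0).re
      = (S.frameNormSq / ((S.Q : ℕ) : ℝ) ^ S.n)⁻¹ * W := by
    rw [hwt, Complex.ofReal_re, hWdef, Finset.mul_sum]
  have hAC : ((A : ℂ)) * (C : ℂ) = ((S.Q : ℕ) : ℂ) := by exact_mod_cast hQ.symm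
  have hQC : ((S.Q : ℕ) : ℂ) ≠ 0 := by exact_mod_cast S.Q.ne_zero
  by_cases hβ : ∀ t, (A : ZMod S.Q) * β t = 0
  · -- case (i): `A·β = 0`
    obtain ⟨hN, hΓ⟩ := S.orbN_orbGamma_of_ann hQ x₀ y₀ hβ x' y'
    by_cases hfull : (A : ZMod S.Q) * (x' - x₀) = 0 ∧
        ∀ t, (A : ZMod S.Q) * (y₀ t - y' t + 2 * ((S.p₁ : ℕ) : ZMod S.Q) * (x₀ - x')
          * ((S.b t.succ / (2 * (S.p₁ : ℤ)) : ℤ) : ZMod S.Q)) = 0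
    · -- the member lies in the orbit span: outcome 0 is CERTAIN
      left
      rw [if_pos hfull.1] at hN
      rw [if_pos hfull.2] at hΓ
      have hWval : W = (S.frameNormSq / ((S.Q : ℕ) : ℝ) ^ S.n) ^ 2 := by
        have hC' : ((W : ℝ) : ℂ) = ((((S.frameNormSq / ((S.Q : ℕ) : ℝ) ^ S.n) ^ 2 : ℝ)) : ℂ) := by
          rw [hWC, hN, hΓ]
          push_cast
          rw [← hAC]
          have hA0 : ((A : ℂ)) ≠ 0 := by
            intro h0; rw [h0, zero_mul] at hAC; exact hQC hAC.symm
          have hC0 : ((C : ℂ)) ≠ 0 := by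
            intro h0; rw [h0, mul_zero] at hAC; exact hQC hAC.symm
          field_simp
          ring
        exact_mod_cast hC'
      unfold POVM.Certain
      apply Complex.ext
      · rw [hwre, hWval, hselfre]
        field_simp
      · rw [hwt, Complex.ofReal_im, hself, Complex.ofReal_im]
    · -- orthogonal to the orbit span: weight 0
      right
      have hWval : W = 0 := by
        have hC' : ((W : ℝ) : ℂ) = 0 := by
          rw [hWC]
          rcases not_and_or.1 hfull with h1 | h1
          · rw [if_neg h1] at hN
            rw [hN]; ring
          · rw [if_neg h1] at hΓ
            rw [hΓ]; ring
        exact_mod_cast hC'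
      rw [hwre, hWval, mul_zero, hselfre]
      positivity
  · -- case (ii): `A·β_{t₀} ≠ 0`: weight at most `⟨u|u⟩/minFac(C)²`
    right
    push Not at hβ
    obtain ⟨t₀, ht₀⟩ := hβ
    have hbound := S.orbN_orbZ_bound hQ t₀ ht₀ x₀ x'
    have hΓ := S.norm_orbGamma_le C x₀ y₀ β x' y'
    have hWle : W ≤ (S.frameNormSq / ((S.Q : ℕ) : ℝ) ^ S.n) ^ 2 / (C.minFac : ℝ) ^ 2 := by
      have hWnorm : W = ‖((W : ℝ) : ℂ)‖ := by
        rw [Complex.norm_real, Real.norm_eq_abs, abs_of_nonneg hW0]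
      rw [hWnorm, hWC]
      simp only [norm_mul, norm_pow, Complex.norm_natCast, Complex.norm_real, norm_div, norm_one,
        Real.norm_eq_abs, abs_of_pos hν]
      calc ((A : ℝ)) ^ S.n * (S.frameNormSq ^ 2 * ((1 / ((S.Q : ℕ) : ℝ) ^ S.n) ^ 2) ^ 2)
              * (S.orbN A x₀ β x' : ℝ) * ‖S.orbGamma C x₀ y₀ β x' y'‖
          ≤ ((A : ℝ)) ^ S.n * (S.frameNormSq ^ 2 * ((1 / ((S.Q : ℕ) : ℝ) ^ S.n) ^ 2) ^ 2)
              * (S.orbN A x₀ β x' : ℝ) * (S.orbZ C β : ℝ) := by gcongr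
        _ = (S.frameNormSq ^ 2 * ((1 / ((S.Q : ℕ) : ℝ) ^ S.n) ^ 2) ^ 2)
              * (((A : ℝ)) ^ S.n * (S.orbN A x₀ β x' : ℝ) * (S.orbZ C β : ℝ)) := by ring
        _ ≤ (S.frameNormSq ^ 2 * ((1 / ((S.Q : ℕ) : ℝ) ^ S.n) ^ 2) ^ 2)
              * (((S.Q : ℕ) : ℝ) ^ (2 * S.n) / (C.minFac : ℝ) ^ 2) := by
            gcongr
            rw [le_div_iff₀ (by positivity)]
            exact hbound
        _ = (S.frameNormSq / ((S.Q : ℕ) : ℝ) ^ S.n) ^ 2 / (C.minFac : ℝ) ^ 2 := by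
            field_simp
            ring
    rw [hwre, hselfre]
    calc (S.frameNormSq / ((S.Q : ℕ) : ℝ) ^ S.n)⁻¹ * W
        ≤ (S.frameNormSq / ((S.Q : ℕ) : ℝ) ^ S.n)⁻¹
            * ((S.frameNormSq / ((S.Q : ℕ) : ℝ) ^ S.n) ^ 2 / (C.minFac : ℝ) ^ 2) := by gcongr
      _ = 1 / (C.minFac : ℝ) ^ 2 * (S.frameNormSq / ((S.Q : ℕ) : ℝ) ^ S.n) := by
            field_simp

/-! ## Part III.  Failure of the ceiling AT `ε = 1/(minFac(C)² + 1)` for every factorisation `Q = A·C`, `C > 1` -/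

/-- **THEOREM (AE1) — the damped divisor-orbit witness.**  For every admissible shape, every coordinate set `U`
and every factorisation `Q = A·C` with `C > 1`, at tolerance `ε = 1/(minFac(C)² + 1)` the divisor-orbit
measurement of (Y) DAMPED by `λ = 1 − ε` ((AC) `POVM.damp`: effects `λΠ`, `1 − λΠ`) is `ε`-almost sure on the
whole class `InClass U` and separates Chen's orbit pair: `S` (inside the orbit) gets outcome `0`, the shifted
instance `(b, v′ + 2D²p₁b)` (orthogonal to the orbit, as `A·(−1) ≠ 0`) gets outcome `1`.  Members in the orbit
span have `λΠ`-weight `λ = 1 − ε`; all others have `Π`-weight `≤ 1/minFac(C)²`, hence `(1 − λΠ)`-weight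
`≥ 1 − λ/minFac(C)² = 1 − ε`.  Improves (Y)'s `1/minFac(C)²`.  A THEOREM about a WITHDRAWN algorithm — not
summit progress. [cite: ChenQuantumLattice2024, §3.1 p. 22, Cond. C.3 p. 18, eq. (35) p. 31, §3.5.8 pp. 33–34;
NielsenChuang2010, §2.2.6 p. 90] -/
theorem step8_povm_ceiling_fails_at_inv_minFac_divisor_sq_succ (h : S.Admissible)
    (U : Finset (Fin (S.n + 1))) {A C : ℕ} (hQ : (S.Q : ℕ) = A * C) (hC : 1 < C) :
    ∃ (E : POVM (Fin (S.n + 1) → ZMod S.M) (Fin 2)) (k k' : Fin 2),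
      S.AlmostSureOn (1 / ((C.minFac : ℝ) ^ 2 + 1)) U E ∧ k ≠ k'
      ∧ E.AlmostCertain (1 / ((C.minFac : ℝ) ^ 2 + 1)) S.phi7d k
      ∧ E.AlmostCertain (1 / ((C.minFac : ℝ) ^ 2 + 1))
          (S.inst S.b (fun i => S.v' i + 2 * (S.D : ℤ) * S.D * S.p₁ * S.b i)).phi7d k' := by
  classical
  obtain ⟨c₀, x₀, y₀, hφS, hφS'⟩ : ∃ (c₀ : S.Coset) (x₀ : ZMod S.Q) (y₀ : Fin S.n → ZMod S.Q),
      S.phi7d = (S.cshape c₀).uKet 0 x₀ y₀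
      ∧ (S.inst S.b (fun i => S.v' i + 2 * (S.D : ℤ) * S.D * S.p₁ * S.b i)).phi7d
          = (S.cshape c₀).uKet 0 (x₀ - 1) (fun t => y₀ t + ((S.b t.succ : ℤ) : ZMod S.Q)) :=
    ⟨_, _, _, S.phi7d_eq_uKet h, S.phi7d_shift_eq_uKet h⟩
  have h₀ : (S.cshape c₀).Admissible := S.cshape_admissible h c₀
  have hmF : (0 : ℝ) < (C.minFac : ℝ) := by exact_mod_cast Nat.minFac_pos C
  have hε0 : (0 : ℝ) ≤ 1 / ((C.minFac : ℝ) ^ 2 + 1) := by positivity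
  have hl0 : (0 : ℝ) ≤ 1 - 1 / ((C.minFac : ℝ) ^ 2 + 1) := by
    rw [sub_nonneg, div_le_one (by positivity)]
    nlinarith
  have hl1 : 1 - 1 / ((C.minFac : ℝ) ^ 2 + 1) ≤ (1 : ℝ) := by linarith
  have hlμ : (1 - 1 / ((C.minFac : ℝ) ^ 2 + 1)) * (1 / (C.minFac : ℝ) ^ 2)
      ≤ 1 / ((C.minFac : ℝ) ^ 2 + 1) := (POVM.damp_factor_eq hmF).le
  refine ⟨((S.cshape c₀).orbitPOVM h₀ A x₀ y₀).damp _ hl0 hl1, 0, 1, ?_, by decide, ?_, ?_⟩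
  · -- almost sure on the whole class
    intro b₂ v₂ hI
    obtain ⟨c, β, x, yb, hφ, -⟩ :=
      S.exists_cmember_of_inClass h (T := Finset.univ) (fun t _ => Finset.mem_univ t) hI
    rw [hφ]
    by_cases hc : c₀ = c
    · subst hc
      rcases (S.cshape c₀).divisorOrbit_weight_dichotomy h₀ hQ hC x₀ y₀ β x yb with hcert | hlow
      · exact ⟨0, POVM.damp_almostCertain_zero _ hl0 hl1 le_rfl hcert⟩
      · exact ⟨1, POVM.damp_almostCertain_one _ hl0 hl1 hlow hlμ⟩
    · have hw0 : ((S.cshape c₀).orbitPOVM h₀ A x₀ y₀).weight ((S.cshape c).uKet β x yb) 0 = 0 :=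
        POVM.ofFrameBinary_weight_zero_of_orthogonal _ _ _ _ fun j =>
          S.star_uKet_dotProduct_cmember_ne h hc 0 _ _ β x yb
      exact ⟨1, POVM.damp_almostCertain_one_of_weight_zero _ hl0 hl1 hε0 hw0⟩
  · -- `S` itself: outcome 0, certainly (it is the orbit member `(r, s̄) = (0, 0)`)
    rw [hφS]
    have hj : (S.cshape c₀).uKet 0 x₀ y₀
        = (S.cshape c₀).orbitVec A x₀ y₀ ⟨(0, 0), by simp⟩ := by
      simp only [orbitVec, add_zero]
    rw [hj]
    exact POVM.damp_almostCertain_zero _ hl0 hl1 le_rfl (POVM.ofFrameBinary_certain_zero_self _ _ _ _)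
  · -- the shifted instance: outcome 1 (it is orthogonal to the whole orbit, as `A·(−1) ≠ 0`)
    rw [hφS']
    have hA0 : ((A : ZMod S.Q)) ≠ 0 := S.natCast_left_ne_zero hQ hC
    have hw0 : ((S.cshape c₀).orbitPOVM h₀ A x₀ y₀).weight
        ((S.cshape c₀).uKet 0 (x₀ - 1) (fun t => y₀ t + ((S.b t.succ : ℤ) : ZMod S.Q))) 0 = 0 := by
      refine POVM.ofFrameBinary_weight_zero_of_orthogonal _ _ _ _ fun j => ?_
      show star ((S.cshape c₀).uKet 0 (x₀ + j.1.1) (y₀ + j.1.2))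
        ⬝ᵥ (S.cshape c₀).uKet 0 (x₀ - 1) (fun t => y₀ t + ((S.b t.succ : ℤ) : ZMod S.Q)) = 0
      rw [(S.cshape c₀).star_uKet_dotProduct_uKet_same h₀, if_neg]
      rintro ⟨hx, -⟩
      have hr : j.1.1 = -1 := by linear_combination hx
      have hj := j.2.1
      rw [hr, mul_neg, mul_one, neg_eq_zero] at hj
      exact hA0 hj
    exact POVM.damp_almostCertain_one_of_weight_zero _ hl0 hl1 hε0 hw0

/-- **COROLLARY (AE2) — failure at `1/(p² + 1)` for every prime `p ∣ Q`**, in particular at `1/(𝔭(Q)² + 1)`,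
`𝔭(Q)` the largest prime factor; improves (Y2)'s `1/p²`.  For prime `Q` (`p = Q`, `A = 1`) the divisor orbit is
the single state `S` and this is (AC2)'s damped rank-one witness, exact by (AD).
[cite: ChenQuantumLattice2024, §3.1 p. 22, Cond. C.3 p. 18; NielsenChuang2010, §2.2.6 p. 90] -/
theorem step8_povm_ceiling_fails_at_inv_prime_sq_succ (h : S.Admissible) (U : Finset (Fin (S.n + 1)))
    {p : ℕ} (hp : p.Prime) (hpQ : p ∣ (S.Q : ℕ)) :
    ∃ (E : POVM (Fin (S.n + 1) → ZMod S.M) (Fin 2)) (k k' : Fin 2),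
      S.AlmostSureOn (1 / ((p : ℝ) ^ 2 + 1)) U E ∧ k ≠ k'
      ∧ E.AlmostCertain (1 / ((p : ℝ) ^ 2 + 1)) S.phi7d k
      ∧ E.AlmostCertain (1 / ((p : ℝ) ^ 2 + 1))
          (S.inst S.b (fun i => S.v' i + 2 * (S.D : ℤ) * S.D * S.p₁ * S.b i)).phi7d k' := by
  have hQ : (S.Q : ℕ) = (S.Q : ℕ) / p * p := (Nat.div_mul_cancel hpQ).symm
  have := S.step8_povm_ceiling_fails_at_inv_minFac_divisor_sq_succ h U hQ hp.one_lt
  rw [hp.minFac_eq] at this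
  exact this

/-! ## Part IV.  The window for EVERY admissible `Q`: `[1/(32·𝔭(Q)²), 1/(𝔭(Q)² + 1)]`, exact for prime `Q` -/

/-- **THEOREM (AE3) — the window of the Step-8 tolerance threshold for every admissible `Q`.**
(ceiling, (Z)) every POVM which is `ε`-almost sure on the class with `32·ε·p² ≤ 1` for every prime `p ∣ Q`
gives `S` and the shifted instance the same almost-certain outcome; (failure, this file) at `ε = 1/(p² + 1)` for
ANY prime `p ∣ Q` some almost-sure two-outcome POVM separates them.  So the threshold lies in
`[1/(32·𝔭(Q)²), 1/(𝔭(Q)² + 1)]`; for PRIME `Q` it IS `1/(Q² + 1)` ((AD) `Shape.step8_tolerance_threshold_all_primes`).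
Whether it is `1/(𝔭(Q)² + 1)` for composite `Q` is NOT decided here.  HONEST FRAMING: a theorem about a WITHDRAWN
algorithm — not summit progress. [cite: ChenQuantumLattice2024, Lemma 3.13 pp. 32–34, §3.5.8 pp. 33–34, p. 37;
NielsenChuang2010, §2.2.6 p. 90] -/
theorem step8_povm_ceiling_window (h : S.Admissible) (U : Finset (Fin (S.n + 1))) :
    (∀ {κ : Type} [Fintype κ] [DecidableEq κ] (t₁ : Fin S.n), t₁.succ ∈ U →
        ∀ (E : POVM (Fin (S.n + 1) → ZMod S.M) κ) {ε : ℝ},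
          (∀ p ∈ (S.Q : ℕ).primeFactors, 32 * ε * (p : ℝ) ^ 2 ≤ 1) →
          S.AlmostSureOn ε U E →
            ∀ k k' : κ, E.AlmostCertain ε S.phi7d k →
              E.AlmostCertain ε (S.inst S.b (fun i => S.v' i + 2 * (S.D : ℤ) * S.D * S.p₁ * S.b i)).phi7d k'
                → k = k')
    ∧ ∀ p ∈ (S.Q : ℕ).primeFactors, ∃ (E : POVM (Fin (S.n + 1) → ZMod S.M) (Fin 2)) (k k' : Fin 2),
        S.AlmostSureOn (1 / ((p : ℝ) ^ 2 + 1)) U E ∧ k ≠ k'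
        ∧ E.AlmostCertain (1 / ((p : ℝ) ^ 2 + 1)) S.phi7d k
        ∧ E.AlmostCertain (1 / ((p : ℝ) ^ 2 + 1))
            (S.inst S.b (fun i => S.v' i + 2 * (S.D : ℤ) * S.D * S.p₁ * S.b i)).phi7d k' :=
  ⟨fun t₁ ht₁ E _ hε hE _ _ hk hk' => S.step8_povm_ceiling_largestPrime h U t₁ ht₁ E hε hE hk hk',
    fun _ hp => S.step8_povm_ceiling_fails_at_inv_prime_sq_succ h U (Nat.prime_of_mem_primeFactors hp)
      (Nat.dvd_of_mem_primeFactors hp)⟩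

/-- **COROLLARY (AE4) — the largest prime factor.**  Failure at `1/(𝔭(Q)² + 1)` with `𝔭(Q)` written as the
maximum of the prime factors of `Q` (nonempty since `Q ≥ 3`). [cite: ChenQuantumLattice2024, §3.1 p. 22,
Cond. C.3 p. 18; NielsenChuang2010, §2.2.6 p. 90] -/
theorem step8_povm_ceiling_fails_at_largestPrime_succ (h : S.Admissible) (U : Finset (Fin (S.n + 1))) :
    ∃ hne : (S.Q : ℕ).primeFactors.Nonempty,
      ∃ (E : POVM (Fin (S.n + 1) → ZMod S.M) (Fin 2)) (k k' : Fin 2),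
        S.AlmostSureOn (1 / ((((S.Q : ℕ).primeFactors.max' hne : ℕ) : ℝ) ^ 2 + 1)) U E ∧ k ≠ k'
        ∧ E.AlmostCertain (1 / ((((S.Q : ℕ).primeFactors.max' hne : ℕ) : ℝ) ^ 2 + 1)) S.phi7d k
        ∧ E.AlmostCertain (1 / ((((S.Q : ℕ).primeFactors.max' hne : ℕ) : ℝ) ^ 2 + 1))
            (S.inst S.b (fun i => S.v' i + 2 * (S.D : ℤ) * S.D * S.p₁ * S.b i)).phi7d k' := by
  have hQ1 : 1 < (S.Q : ℕ) := by have := h.three_le_Q; omega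
  have hne : (S.Q : ℕ).primeFactors.Nonempty := Nat.nonempty_primeFactors.2 hQ1
  refine ⟨hne, ?_⟩
  have hmem := Finset.max'_mem _ hne
  exact S.step8_povm_ceiling_fails_at_inv_prime_sq_succ h U (Nat.prime_of_mem_primeFactors hmem)
    (Nat.dvd_of_mem_primeFactors hmem)

end Shape

end Literature.Computability.Cryptography.Chen2024
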